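import Literature.LinearAlgebra.Matrix.MirabolicOrbit
import Literature.NumberTheory.Automorphic.AdeleQuotientParseval
import Literature.NumberTheory.Automorphic.GLnCuspidalSpectrum
import Literature.NumberTheory.Automorphic.RankinSelbergLocal
import HarnessLib

/-!
# The Fourier–Whittaker stage identity for `GL_n` in mean square
(Jacquet–Shalika, *On Euler products and the classification of automorphic representations I*,
Amer. J. Math. **103** (1981), §4; Cogdell, *Analytic theory of L-functions for GL_n* (2004), §1.1,
proof of Thm. 1.1 (Piatetski-Shapiro, Shalika): expansion along the abelian column group
`U ≅ k^{m}` of the mirabolic, "`P_n \ GL_n ≃ kⁿ - {0}`")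

Topic `NumberTheory/Automorphic`; namespace `Literature.NumberTheory.Automorphic`. Brick (M2) of the
real-point (mean-square) Rankin–Selberg route to the named fact
`JacquetShalika1981_schurSelfSum_prod_bounded` of `JacquetShalikaSchurSelfSum` (on which
`multipliable_partialStandardL`, `StandardLFunctionData.L_eq_partialStandardL_mul`, … of
`AutomorphicLFunction` rest). One step of the Fourier–Whittaker expansion of a cusp form `φ` on
`GL_n(𝔸_K)` is the expansion of `v ↦ φ(u(v) x)` along a **column group**
`u = u_m : 𝔸_K^m → GL_n(𝔸_K)`, `u(v) = 1 + ∑_{i<m} v_i E_{i,m}` (the `m`-th column above the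
diagonal, `m < n`; for `m = n - 1` the unipotent radical of the mirabolic), whose characters are
`v ↦ ψ(ξ · v)`, `ξ ∈ K^m`. The printed expansion `φ(x) = ∑_ξ φ_ξ(x)`, `φ_0 = 0` (cuspidality),
`φ_{e γ}(x) = φ_e(diag(γ, 1) x)` (`γ ∈ P_m(K) \ GL_m(K)`) needs smoothness and absolute
convergence; its **mean-square form** needs only continuity and is an *identity of non-negative
series* (Parseval on `K^m \ 𝔸_K^m`, `AdeleQuotientParseval`):

  `λ(D)⁻¹ ∫_D |φ(u(v) x)|² dv = ∑_{γ ∈ P_m(K) \ GL_m(K)} |Φ(diag(γ, 1) x)|²`,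
  `Φ(x) = λ(D)⁻¹ ∫_D conj ψ(v_{m-1}) φ(u(v) x) dv`

(`D = D^m` Tate's box fundamental domain for `K^m` in `𝔸_K^m`). This file proves it for every `m`
(all stages of the tower at once), for any continuous `φ : GL_n(𝔸_K) → ℂ` that is left invariant
under the rational corner `diag(GL_m(K), 1)` and under `u(K^m)` and whose `ξ = 0` coefficient
vanishes at `x`:

* `cornerBlock`, `colVec`, `colUnipotent` (**definitions**, over any commutative ring): the top-right
  block `𝔫_m` in `(m, n-m)`-block form (into the tree's `blockNilpotent n m R` of
  `GLnCuspidalSpectrum`), the first column of that block, and the column group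
  `u : 𝔸^m →* GL_n` (through `unipotentOfBlock`); `coe_colUnipotent`; `continuous_colUnipotent`;
  **`glCorner_mul_unipotentOfBlock_cornerBlock`** / `glCorner_mul_colUnipotent`:
  `diag(γ, 1) · (1 + B) = (1 + γ B) · diag(γ, 1)` (the corner `glCorner` of `RankinSelbergLocal`
  acts on the block by left multiplication, on the column by `v ↦ γ v`).
* `piPeriodicLift`, `setIntegral_piFundamentalDomain_comp_mulVec` — **rational change of variables
  on `D^m`**: for `γ ∈ GL_m(K)` and `F` continuous and `K^m`-periodic,
  `∫_D F(γ v) dv = ∫_D F(v) dv` (`v ↦ γ v` induces a continuous automorphism of the compact group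
  `𝔸_K^m ⧸ K^m`, which preserves its Haar probability measure — Mathlib
  `AddMonoidHom.measurePreserving`; Tate's Lemma 4.2.1 to pass to and from `D`). No adelic modulus
  `|det γ|_𝔸 = 1` is needed.
* `colCoeff h ν φ ξ x = λ(D)⁻¹ ∫_D conj ψ(∑ ξ_i v_i) φ(u(v) x) dv` (**definition**: the `ξ`-th
  column Fourier coefficient, Tate's character `ψ = adeleAddChar K`); `colCoeff_lastRow`
  (**`φ_{e γ}(x) = φ_e(diag(γ,1) x)`**); `colCoeff_lastVec_glCorner_of_mem_mirabolic` (`Φ = φ_e`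
  is left invariant under the rational mirabolic `diag(P_m(K), 1)`).
* `hasSum_norm_sq_colCoeff` (**the stage identity over `ξ ≠ 0`**) and
  `hasSum_norm_sq_colCoeff_mirabolic` (**over `P_m(K) \ GL_m(K)`**, through
  `Literature.LinearAlgebra.Matrix.mirabolicQuotientEquiv`).

Not here: the vanishing of the `ξ = 0` coefficient from cuspidality (for the last column it is the
constant term along `P_{(n-1,1)}`; for lower columns it needs the previous stages), the iteration
down the tower, and the integration of the identity over `x`.

## References

* H. Jacquet, J. A. Shalika, Amer. J. Math. 103 (1981), 499–558, §4 [JacquetShalikaAJM1981].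
* J. W. Cogdell, in Bernstein–Gelbart (eds.), *An Introduction to the Langlands Program* (2004),
  §1.1 (Thm. 1.1 and its proof), §2.1 [CogdellAnalyticTheory2004].
* J. Tate, in Cassels–Fröhlich (eds.), *Algebraic Number Theory* (1967), Ch. XV, Lemma 4.2.1
  [CasselsFrohlichANT1967].
-/

noncomputable section

open scoped Matrix ComplexConjugate ENNReal Pointwise
open NumberField IsDedekindDomain MeasureTheory Function
open Literature.LinearAlgebra.Matrix

namespace Literature.NumberTheory.Automorphic

/-! ### Block and column unipotents over a commutative ring -/

section Ring

variable {R : Type*} [CommRing R] {n m : ℕ}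

/-- The matrix `(0 B; 0 0)` in `(m, n-m)`-block form lies in `𝔫_m` (`blockNilpotent n m R`: non-zero
entries only in rows `< m` and columns `≥ m`). [folklore] -/
theorem reindex_fromBlocks_mem_blockNilpotent (h : m ≤ n) (B : Matrix (Fin m) (Fin (n - m)) R) :
    Matrix.reindex (finBlockEquiv h) (finBlockEquiv h) (Matrix.fromBlocks 0 B 0 0) ∈
      blockNilpotent n m R := by
  intro i j hij
  obtain ⟨x, rfl⟩ := (finBlockEquiv h).surjective i
  obtain ⟨y, rfl⟩ := (finBlockEquiv h).surjective j
  simp only [Matrix.reindex_apply, Matrix.submatrix_apply, Equiv.symm_apply_apply] at hij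
  rcases x with a | b <;> rcases y with a' | b'
  · simp at hij
  · refine ⟨?_, ?_⟩
    · rw [coe_finBlockEquiv_inl]; exact a.isLt
    · rw [coe_finBlockEquiv_inr]; exact Nat.le_add_right m b'
  · simp at hij
  · simp at hij

/-- The **top-right block embedding** `B ↦ (0 B; 0 0)` of `m × (n - m)` matrices into the
block-nilpotent matrices `𝔫_m ≤ M_n(R)` (`blockNilpotent n m R` of `GLnCuspidalSpectrum`), in the
`(m, n-m)`-block form of `finBlockEquiv` (`RankinSelbergLocal`). [folklore] -/
def cornerBlock (h : m ≤ n) : Matrix (Fin m) (Fin (n - m)) R →+ blockNilpotent n m R where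
  toFun B := ⟨Matrix.reindex (finBlockEquiv h) (finBlockEquiv h) (Matrix.fromBlocks 0 B 0 0),
    reindex_fromBlocks_mem_blockNilpotent h B⟩
  map_zero' := Subtype.ext (by simp)
  map_add' B B' := Subtype.ext (by
    simp only [AddSubgroup.coe_add, Matrix.reindex_apply]
    change _ = (Matrix.fromBlocks 0 B 0 0 + Matrix.fromBlocks 0 B' 0 0).submatrix _ _
    simp only [Matrix.fromBlocks_add, add_zero])

/-- The underlying matrix of `cornerBlock h B` is `(0 B; 0 0)` (definitional). [folklore] -/
@[simp]
theorem coe_cornerBlock (h : m ≤ n) (B : Matrix (Fin m) (Fin (n - m)) R) :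
    ((cornerBlock h B : blockNilpotent n m R) : Matrix (Fin n) (Fin n) R) =
      Matrix.reindex (finBlockEquiv h) (finBlockEquiv h) (Matrix.fromBlocks 0 B 0 0) :=
  rfl

/-- The unipotent `1 + (0 B; 0 0)` is `(1 B; 0 1)` in block form. [folklore] -/
theorem coe_unipotentOfBlock_cornerBlock (h : m ≤ n) (B : Matrix (Fin m) (Fin (n - m)) R) :
    ((unipotentOfBlock n m R (Multiplicative.ofAdd (cornerBlock h B)) : GL (Fin n) R) :
        Matrix (Fin n) (Fin n) R) =
      Matrix.reindex (finBlockEquiv h) (finBlockEquiv h) (Matrix.fromBlocks 1 B 0 1) := by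
  rw [coe_unipotentOfBlock, toAdd_ofAdd, coe_cornerBlock, Matrix.reindex_apply, Matrix.reindex_apply]
  conv_lhs => rw [← Matrix.submatrix_one_equiv (finBlockEquiv h).symm]
  change ((1 : Matrix (Fin m ⊕ Fin (n - m)) (Fin m ⊕ Fin (n - m)) R) +
    Matrix.fromBlocks 0 B 0 0).submatrix _ _ = _
  simp only [← Matrix.fromBlocks_one, Matrix.fromBlocks_add, add_zero, zero_add]

/-- **The rational corner acts on the block by left multiplication**:
`diag(γ, 1) · (1 + (0 B; 0 0)) = (1 + (0 γB; 0 0)) · diag(γ, 1)` in `GL_n(R)`, for `γ ∈ GL_m(R)`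
(`glCorner` of `RankinSelbergLocal`). [folklore] -/
theorem glCorner_mul_unipotentOfBlock_cornerBlock (h : m ≤ n) (γ : GL (Fin m) R)
    (B : Matrix (Fin m) (Fin (n - m)) R) :
    glCorner R h γ * unipotentOfBlock n m R (Multiplicative.ofAdd (cornerBlock h B)) =
      unipotentOfBlock n m R (Multiplicative.ofAdd (cornerBlock h ((γ : Matrix (Fin m) (Fin m) R) * B))) *
        glCorner R h γ := by
  refine Units.ext ?_
  rw [Units.val_mul, Units.val_mul, coe_unipotentOfBlock_cornerBlock, coe_unipotentOfBlock_cornerBlock,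
    coe_glCorner]
  simp only [Matrix.reindex_apply, Matrix.submatrix_mul_equiv, Matrix.fromBlocks_multiply,
    Matrix.mul_zero, Matrix.zero_mul, add_zero, zero_add, Matrix.mul_one, Matrix.one_mul]

variable (n) in
/-- The **column matrix** `colVec v`: the `m × (n - m)` block whose first column is `v` and whose
other columns vanish, so that `(1 colVec v; 0 1) = 1 + ∑_{i<m} v_i E_{i,m}`. [folklore] -/
def colVec : (Fin m → R) →+ Matrix (Fin m) (Fin (n - m)) R where
  toFun v := Matrix.of fun i j => if (j : ℕ) = 0 then v i else 0
  map_zero' := by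
    ext i j
    simp
  map_add' v w := by
    ext i j
    simp only [Matrix.of_apply, Pi.add_apply, Matrix.add_apply]
    split_ifs <;> simp

/-- Entries of `colVec`. [folklore] -/
@[simp]
theorem colVec_apply (v : Fin m → R) (i : Fin m) (j : Fin (n - m)) :
    colVec n v i j = if (j : ℕ) = 0 then v i else 0 :=
  rfl

/-- `γ · colVec v = colVec (γ v)`: left multiplication on the block is `v ↦ γ v` on the column.
[folklore] -/
theorem mul_colVec (γ : Matrix (Fin m) (Fin m) R) (v : Fin m → R) :
    γ * colVec n v = colVec n (m := m) (γ *ᵥ v) := by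
  ext i j
  simp only [Matrix.mul_apply, colVec_apply, Matrix.mulVec, dotProduct, mul_ite, mul_zero]
  split_ifs <;> simp

variable (n) in
/-- The **column group** `u = u_m : R^m →* GL_n(R)`, `u(v) = 1 + ∑_{i<m} v_i E_{i,m}` (written on
`Multiplicative (Fin m → R)`; the `m`-th column above the diagonal, through `unipotentOfBlock` of
`GLnCuspidalSpectrum`): for `m = n - 1` the unipotent radical `U_n ≅ 𝔾_a^{n-1}` of the mirabolic
(Cogdell (2004), §1.1), in general the last column of the corner `GL_{m+1}`.
[cite: CogdellAnalyticTheory2004, §1.1] -/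
def colUnipotent (h : m ≤ n) : Multiplicative (Fin m → R) →* GL (Fin n) R :=
  (unipotentOfBlock n m R).comp (AddMonoidHom.toMultiplicative ((cornerBlock h).comp (colVec n)))

/-- `colUnipotent` is `unipotentOfBlock` of the embedded column (definitional). [folklore] -/
theorem colUnipotent_apply (h : m ≤ n) (v : Fin m → R) :
    colUnipotent n h (Multiplicative.ofAdd v) =
      unipotentOfBlock n m R (Multiplicative.ofAdd (cornerBlock h (colVec n v))) :=
  rfl

/-- The underlying matrix of `u(v)` is `(1 colVec v; 0 1)` in block form. [folklore] -/
theorem coe_colUnipotent (h : m ≤ n) (v : Fin m → R) :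
    ((colUnipotent n h (Multiplicative.ofAdd v) : GL (Fin n) R) : Matrix (Fin n) (Fin n) R) =
      Matrix.reindex (finBlockEquiv h) (finBlockEquiv h) (Matrix.fromBlocks 1 (colVec n v) 0 1) := by
  rw [colUnipotent_apply, coe_unipotentOfBlock_cornerBlock]

/-- The underlying matrix of `u(v)` is `1 + (0 colVec v; 0 0)`. [folklore] -/
theorem coe_colUnipotent' (h : m ≤ n) (v : Fin m → R) :
    ((colUnipotent n h (Multiplicative.ofAdd v) : GL (Fin n) R) : Matrix (Fin n) (Fin n) R) =
      1 + Matrix.reindex (finBlockEquiv h) (finBlockEquiv h) (Matrix.fromBlocks 0 (colVec n v) 0 0) :=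
  rfl

/-- The underlying matrix of `u(v)⁻¹` is `1 - (0 colVec v; 0 0)`. [folklore] -/
theorem coe_colUnipotent_inv (h : m ≤ n) (v : Fin m → R) :
    (((colUnipotent n h (Multiplicative.ofAdd v))⁻¹ : GL (Fin n) R) : Matrix (Fin n) (Fin n) R) =
      1 - Matrix.reindex (finBlockEquiv h) (finBlockEquiv h) (Matrix.fromBlocks 0 (colVec n v) 0 0) :=
  rfl

/-- **The rational corner acts on the column group by `v ↦ γ v`**:
`diag(γ, 1) · u(v) = u(γ v) · diag(γ, 1)`. [folklore] -/
theorem glCorner_mul_colUnipotent (h : m ≤ n) (γ : GL (Fin m) R) (v : Fin m → R) :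
    glCorner R h γ * colUnipotent n h (Multiplicative.ofAdd v) =
      colUnipotent n h (Multiplicative.ofAdd ((γ : Matrix (Fin m) (Fin m) R) *ᵥ v)) * glCorner R h γ := by
  rw [colUnipotent_apply, colUnipotent_apply, glCorner_mul_unipotentOfBlock_cornerBlock, mul_colVec]

/-- Equivalently `u(v) · diag(γ, 1) = diag(γ, 1) · u(γ⁻¹ v)`. [folklore] -/
theorem colUnipotent_mul_glCorner (h : m ≤ n) (γ : GL (Fin m) R) (v : Fin m → R) :
    colUnipotent n h (Multiplicative.ofAdd v) * glCorner R h γ =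
      glCorner R h γ * colUnipotent n h (Multiplicative.ofAdd (((γ⁻¹ : GL (Fin m) R) :
        Matrix (Fin m) (Fin m) R) *ᵥ v)) := by
  rw [glCorner_mul_colUnipotent, Matrix.mulVec_mulVec]
  have : ((γ : Matrix (Fin m) (Fin m) R) * ((γ⁻¹ : GL (Fin m) R) : Matrix (Fin m) (Fin m) R)) = 1 := by
    rw [← Units.val_mul, mul_inv_cancel, Units.val_one]
  rw [this, Matrix.one_mulVec]

/-- `u` is additive: `u(v + w) = u(v) u(w)`. [folklore] -/
theorem colUnipotent_add (h : m ≤ n) (v w : Fin m → R) :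
    colUnipotent n h (Multiplicative.ofAdd (v + w)) =
      colUnipotent n h (Multiplicative.ofAdd v) * colUnipotent n h (Multiplicative.ofAdd w) := by
  rw [ofAdd_add, map_mul]

end Ring

/-! ### Continuity of the column group over a topological ring -/

section Topology

variable {R : Type*} [CommRing R] [TopologicalSpace R] [IsTopologicalRing R] {n m : ℕ}

/-- `v ↦ u(v) : R^m → GL_n(R)` is continuous (entries of `u(v)` and of `u(v)⁻¹ = u(-v)` are
continuous in `v`; Mathlib `Units.continuous_iff`). [folklore] -/
theorem continuous_colUnipotent (h : m ≤ n) :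
    Continuous fun v : Fin m → R => (colUnipotent n h (Multiplicative.ofAdd v) : GL (Fin n) R) := by
  have hB : Continuous fun v : Fin m → R =>
      Matrix.reindex (finBlockEquiv h) (finBlockEquiv h) (Matrix.fromBlocks 0 (colVec n v) 0 0) := by
    refine Continuous.matrix_reindex ?_ _ _
    refine Continuous.matrix_fromBlocks continuous_const ?_ continuous_const continuous_const
    refine continuous_matrix fun i j => ?_
    simp only [colVec_apply]
    split_ifs
    · exact continuous_apply i
    · exact continuous_const
  refine Units.continuous_iff.2 ⟨?_, ?_⟩
  · show Continuous fun v : Fin m → R => ((colUnipotent n h (Multiplicative.ofAdd v) : GL (Fin n) R) :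
        Matrix (Fin n) (Fin n) R)
    have e : (fun v : Fin m → R => ((colUnipotent n h (Multiplicative.ofAdd v) : GL (Fin n) R) :
        Matrix (Fin n) (Fin n) R)) = fun v => 1 + Matrix.reindex (finBlockEquiv h) (finBlockEquiv h)
          (Matrix.fromBlocks 0 (colVec n v) 0 0) := funext fun v => coe_colUnipotent' h v
    rw [e]
    exact continuous_const.add hB
  · show Continuous fun v : Fin m → R =>
      (((colUnipotent n h (Multiplicative.ofAdd v))⁻¹ : GL (Fin n) R) : Matrix (Fin n) (Fin n) R)
    have e : (fun v : Fin m → R => (((colUnipotent n h (Multiplicative.ofAdd v))⁻¹ : GL (Fin n) R) :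
        Matrix (Fin n) (Fin n) R)) = fun v => 1 - Matrix.reindex (finBlockEquiv h) (finBlockEquiv h)
          (Matrix.fromBlocks 0 (colVec n v) 0 0) := funext fun v => coe_colUnipotent_inv h v
    rw [e]
    exact continuous_const.sub hB

end Topology

/-! ### Rational changes of variables on `D^m` -/

section Adelic

variable (K : Type) [Field K] [NumberField K] {m : ℕ}

/-- The descent of a `K^m`-periodic function on `𝔸_K^m` to the compact quotient `𝔸_K^m ⧸ K^m`
(`piPrincipalSubgroup`). [folklore] -/
def piPeriodicLift {E : Type*} (F : (Fin m → AdeleRing (𝓞 K) K) → E)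
    (hF : ∀ (v : Fin m → AdeleRing (𝓞 K) K) (γ : piPrincipalSubgroup K (Fin m)), F (v + γ) = F v) :
    (Fin m → AdeleRing (𝓞 K) K) ⧸ piPrincipalSubgroup K (Fin m) → E :=
  Quotient.lift (s := QuotientAddGroup.leftRel (piPrincipalSubgroup K (Fin m))) F fun a b hab => by
    have h : -a + b ∈ piPrincipalSubgroup K (Fin m) := QuotientAddGroup.leftRel_apply.1 hab
    have h' : F (a + (-a + b)) = F a := hF a ⟨-a + b, h⟩
    rw [add_neg_cancel_left] at h'
    exact h'.symm

variable {K} in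
/-- `piPeriodicLift F (v + K^m) = F v` (definitional). [folklore] -/
@[simp]
theorem piPeriodicLift_mk {E : Type*} (F : (Fin m → AdeleRing (𝓞 K) K) → E)
    (hF : ∀ (v : Fin m → AdeleRing (𝓞 K) K) (γ : piPrincipalSubgroup K (Fin m)), F (v + γ) = F v)
    (v : Fin m → AdeleRing (𝓞 K) K) :
    piPeriodicLift K F hF (QuotientAddGroup.mk v) = F v :=
  rfl

variable {K} in
/-- The descent of a continuous periodic function is continuous. [folklore] -/
theorem continuous_piPeriodicLift {E : Type*} [TopologicalSpace E]
    {F : (Fin m → AdeleRing (𝓞 K) K) → E}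
    (hF : ∀ (v : Fin m → AdeleRing (𝓞 K) K) (γ : piPrincipalSubgroup K (Fin m)), F (v + γ) = F v)
    (hFc : Continuous F) : Continuous (piPeriodicLift K F hF) := by
  rw [(QuotientAddGroup.isQuotientMap_mk (piPrincipalSubgroup K (Fin m))).continuous_iff]
  exact hFc

variable {K} in
/-- Periodicity under `K^m` written with rational vectors gives periodicity under the subgroup
`piPrincipalSubgroup`. [folklore] -/
theorem periodic_of_forall_add_algebraMap {E : Type*} {F : (Fin m → AdeleRing (𝓞 K) K) → E}
    (hF : ∀ (v : Fin m → AdeleRing (𝓞 K) K) (ξ : Fin m → K),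
      F (v + fun i => algebraMap K (AdeleRing (𝓞 K) K) (ξ i)) = F v)
    (v : Fin m → AdeleRing (𝓞 K) K) (γ : piPrincipalSubgroup K (Fin m)) : F (v + γ) = F v := by
  obtain ⟨ξ, hξ⟩ := (piPrincipalSubgroupEquiv K (Fin m)).surjective γ
  have : (γ : Fin m → AdeleRing (𝓞 K) K) = fun i => algebraMap K (AdeleRing (𝓞 K) K) (ξ i) := by
    rw [← hξ, coe_piPrincipalSubgroupEquiv]
  rw [this]
  exact hF v ξ

/-- The adelic points `γ_𝔸 ∈ GL_m(𝔸_K)` of a rational matrix `γ ∈ GL_m(K)` (diagonal embedding of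
the entries). [folklore] -/
abbrev ratGL (γ : GL (Fin m) K) : GL (Fin m) (AdeleRing (𝓞 K) K) :=
  Matrix.GeneralLinearGroup.map (algebraMap K (AdeleRing (𝓞 K) K)) γ

variable {K} in
/-- Entries of `ratGL K γ` are the principal adeles of the entries of `γ`. [folklore] -/
theorem ratGL_apply (γ : GL (Fin m) K) (i j : Fin m) :
    ((ratGL K γ : GL (Fin m) (AdeleRing (𝓞 K) K)) : Matrix (Fin m) (Fin m) (AdeleRing (𝓞 K) K)) i j =
      algebraMap K (AdeleRing (𝓞 K) K) ((γ : Matrix (Fin m) (Fin m) K) i j) :=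
  rfl

variable {K} in
/-- **`v ↦ γ_𝔸 v` preserves the lattice `K^m`**. [folklore] -/
theorem mulVec_ratGL_mem_piPrincipalSubgroup (γ : GL (Fin m) K) {v : Fin m → AdeleRing (𝓞 K) K}
    (hv : v ∈ piPrincipalSubgroup K (Fin m)) :
    ((ratGL K γ : GL (Fin m) (AdeleRing (𝓞 K) K)) : Matrix (Fin m) (Fin m) (AdeleRing (𝓞 K) K)) *ᵥ v ∈
      piPrincipalSubgroup K (Fin m) := by
  rw [mem_piPrincipalSubgroup_iff] at hv ⊢
  choose ξ hξ using hv
  intro i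
  refine ⟨∑ j, (γ : Matrix (Fin m) (Fin m) K) i j * ξ j, ?_⟩
  change algebraMap K (AdeleRing (𝓞 K) K) (∑ j, (γ : Matrix (Fin m) (Fin m) K) i j * ξ j) = _
  rw [map_sum, Matrix.mulVec, dotProduct]
  refine Finset.sum_congr rfl fun j _ => ?_
  rw [map_mul, ratGL_apply]
  congr 1
  exact hξ j

variable {K} in
/-- `γ_𝔸 (γ⁻¹_𝔸 v) = v`. [folklore] -/
theorem mulVec_ratGL_mulVec_ratGL_inv (γ : GL (Fin m) K) (v : Fin m → AdeleRing (𝓞 K) K) :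
    ((ratGL K γ : GL (Fin m) (AdeleRing (𝓞 K) K)) : Matrix (Fin m) (Fin m) (AdeleRing (𝓞 K) K)) *ᵥ
      (((ratGL K γ⁻¹ : GL (Fin m) (AdeleRing (𝓞 K) K)) : Matrix (Fin m) (Fin m) (AdeleRing (𝓞 K) K)) *ᵥ
        v) = v := by
  rw [Matrix.mulVec_mulVec, ← Units.val_mul, ← map_mul, mul_inv_cancel, map_one, Units.val_one,
    Matrix.one_mulVec]

variable {K} in
/-- **Rational change of variables on the box `D^m`.** For `γ ∈ GL_m(K)`, an additive Haar measure
`ν` on `𝔸_K^m` and `F : 𝔸_K^m → E` continuous and `K^m`-periodic,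
`∫_{D^m} F(γ_𝔸 v) dν(v) = ∫_{D^m} F(v) dν(v)`. Proof: `v ↦ γ_𝔸 v` maps `K^m` onto itself, so it
induces a continuous surjective endomorphism of the compact group `𝔸_K^m ⧸ K^m`, which preserves the
Haar probability measure (Mathlib `AddMonoidHom.measurePreserving`); pass between `D^m` and the
quotient by Tate's Lemma 4.2.1 (`Literature.Analysis.Fourier.integral_fundamentalDomain_comp_mk`).
The modulus `|det γ|_𝔸 = 1` (product formula) is not needed. [cite: CasselsFrohlichANT1967, Ch. XV Lemma 4.2.1] -/
theorem setIntegral_piFundamentalDomain_comp_mulVec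
    [MeasurableSpace (AdeleRing (𝓞 K) K)] [BorelSpace (AdeleRing (𝓞 K) K)]
    (ν : Measure (Fin m → AdeleRing (𝓞 K) K)) [ν.IsAddHaarMeasure] (γ : GL (Fin m) K)
    {E : Type*} [NormedAddCommGroup E] [NormedSpace ℝ E]
    {F : (Fin m → AdeleRing (𝓞 K) K) → E} (hFc : Continuous F)
    (hF : ∀ (v : Fin m → AdeleRing (𝓞 K) K) (ξ : Fin m → K),
      F (v + fun i => algebraMap K (AdeleRing (𝓞 K) K) (ξ i)) = F v) :
    ∫ v in piFundamentalDomain K (Fin m),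
        F (((ratGL K γ : GL (Fin m) (AdeleRing (𝓞 K) K)) :
          Matrix (Fin m) (Fin m) (AdeleRing (𝓞 K) K)) *ᵥ v) ∂ν =
      ∫ v in piFundamentalDomain K (Fin m), F v ∂ν := by
  haveI := locallyCompactSpace_adeleRing' K
  haveI := secondCountableTopology_adeleRing K
  haveI := t2Space_adeleRing K
  haveI : Countable K := NumberField.countable' (K := K)
  haveI : BorelSpace (Fin m → AdeleRing (𝓞 K) K) := Pi.borelSpace
  letI : MeasurableSpace ((Fin m → AdeleRing (𝓞 K) K) ⧸ piPrincipalSubgroup K (Fin m)) := borel _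
  haveI : BorelSpace ((Fin m → AdeleRing (𝓞 K) K) ⧸ piPrincipalSubgroup K (Fin m)) := ⟨rfl⟩
  set A : Matrix (Fin m) (Fin m) (AdeleRing (𝓞 K) K) :=
    ((ratGL K γ : GL (Fin m) (AdeleRing (𝓞 K) K)) : Matrix (Fin m) (Fin m) (AdeleRing (𝓞 K) K)) with hA
  set A' : Matrix (Fin m) (Fin m) (AdeleRing (𝓞 K) K) :=
    ((ratGL K γ⁻¹ : GL (Fin m) (AdeleRing (𝓞 K) K)) : Matrix (Fin m) (Fin m) (AdeleRing (𝓞 K) K))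
    with hA'
  have hfin : ν (piFundamentalDomain K (Fin m)) ≠ ⊤ :=
    ((measure_mono subset_closure).trans_lt
      (isCompact_closure_piFundamentalDomain K (Fin m)).measure_lt_top).ne
  -- the linear map `T v = γ_𝔸 v`, its descent `T̄` to the quotient
  let T : (Fin m → AdeleRing (𝓞 K) K) →+ (Fin m → AdeleRing (𝓞 K) K) := A.mulVecLin.toAddMonoidHom
  have hTapply : ∀ v, T v = A *ᵥ v := fun v => rfl
  have hTc : Continuous T := continuous_const.matrix_mulVec continuous_id
  have hTΛ : piPrincipalSubgroup K (Fin m) ≤ (piPrincipalSubgroup K (Fin m)).comap T := fun v hv => by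
    rw [AddSubgroup.mem_comap, hTapply]
    exact mulVec_ratGL_mem_piPrincipalSubgroup γ hv
  let Tq := QuotientAddGroup.map (piPrincipalSubgroup K (Fin m)) (piPrincipalSubgroup K (Fin m)) T hTΛ
  have hTq_mk : ∀ v, Tq (QuotientAddGroup.mk v) = QuotientAddGroup.mk (A *ᵥ v) := fun v => rfl
  have hTqc : Continuous Tq := by
    rw [(QuotientAddGroup.isQuotientMap_mk (piPrincipalSubgroup K (Fin m))).continuous_iff]
    change Continuous fun v => Tq (QuotientAddGroup.mk v)
    simp_rw [hTq_mk]
    exact (QuotientAddGroup.continuous_mk (N := piPrincipalSubgroup K (Fin m))).comp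
      (continuous_const.matrix_mulVec continuous_id)
  have hTqs : Surjective Tq := by
    intro q
    obtain ⟨w, rfl⟩ := QuotientAddGroup.mk_surjective q
    refine ⟨QuotientAddGroup.mk (A' *ᵥ w), ?_⟩
    rw [hTq_mk, hA, hA', mulVec_ratGL_mulVec_ratGL_inv]
  set μQ : Measure ((Fin m → AdeleRing (𝓞 K) K) ⧸ piPrincipalSubgroup K (Fin m)) :=
    Measure.addHaarMeasure ⊤ with hμQ
  have hmp : MeasurePreserving Tq μQ μQ := AddMonoidHom.measurePreserving hTqc hTqs rfl
  -- descend `F` and compute both sides on the quotient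
  have hF' := periodic_of_forall_add_algebraMap hF
  set G := piPeriodicLift K F hF' with hG
  have hGc : Continuous G := continuous_piPeriodicLift hF' hFc
  have h1 : ∫ v in piFundamentalDomain K (Fin m), F (A *ᵥ v) ∂ν =
      (ν (piFundamentalDomain K (Fin m))).toReal • ∫ q, (G ∘ Tq) q ∂μQ :=
    Literature.Analysis.Fourier.integral_fundamentalDomain_comp_mk ν (isClosed_piPrincipalSubgroup K (Fin m))
      (isAddFundamentalDomain_op_piFundamentalDomain K (Fin m) ν) hfin (G := G ∘ Tq)
      (hGc.comp hTqc).aestronglyMeasurable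
  have h2 : ∫ q, (G ∘ Tq) q ∂μQ = ∫ q, G q ∂μQ := by
    have := integral_map (μ := μQ) hmp.measurable.aemeasurable (hGc.aestronglyMeasurable (μ := μQ.map Tq))
    rw [hmp.map_eq] at this
    exact this.symm
  have h3 : ∫ v in piFundamentalDomain K (Fin m), F v ∂ν =
      (ν (piFundamentalDomain K (Fin m))).toReal • ∫ q, G q ∂μQ :=
    Literature.Analysis.Fourier.integral_fundamentalDomain_comp_mk ν (isClosed_piPrincipalSubgroup K (Fin m))
      (isAddFundamentalDomain_op_piFundamentalDomain K (Fin m) ν) hfin (G := G) hGc.aestronglyMeasurable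
  rw [h1, h2, ← h3]

end Adelic

/-! ### Column Fourier coefficients and the stage identity -/

section Stage

variable (K : Type) [Field K] [NumberField K] {n c : ℕ} [MeasurableSpace (AdeleRing (𝓞 K) K)]

variable {K} in
/-- The **`ξ`-th column Fourier coefficient** of `φ : GL_n(𝔸_K) → ℂ` along the column group
`u : 𝔸_K^{c+1} → GL_n(𝔸_K)` at `x`:
`φ_ξ(x) = λ(D)⁻¹ ∫_D conj ψ(∑ ξ_i v_i) φ(u(v) x) dλ(v)`, `D = D^{c+1}` Tate's box fundamental domain
for `K^{c+1}` in `𝔸_K^{c+1}`, `ψ = adeleAddChar K` (Cogdell (2004), §1.1: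
`φ_ξ(g) = ∫_{k^{m} \ 𝔸^{m}} φ(u g) ψ_ξ⁻¹(u) du` with the probability Haar measure). The integral is a
Bochner integral (junk `0` if not integrable; it is a genuine integral for continuous `φ`).
[cite: CogdellAnalyticTheory2004, §1.1] -/
def colCoeff (h : c + 1 ≤ n) (ν : Measure (Fin (c + 1) → AdeleRing (𝓞 K) K))
    (φ : GL (Fin n) (AdeleRing (𝓞 K) K) → ℂ) (ξ : Fin (c + 1) → K)
    (x : GL (Fin n) (AdeleRing (𝓞 K) K)) : ℂ :=
  ((ν (piFundamentalDomain K (Fin (c + 1)))).toReal⁻¹ : ℝ) •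
    ∫ v in piFundamentalDomain K (Fin (c + 1)),
      conj (adeleAddChar K (∑ i, algebraMap K (AdeleRing (𝓞 K) K) (ξ i) * v i) : ℂ) *
        φ (colUnipotent n h (Multiplicative.ofAdd v) * x) ∂ν

variable {K} in
/-- Unfolding of `colCoeff`. [folklore] -/
theorem colCoeff_apply (h : c + 1 ≤ n) (ν : Measure (Fin (c + 1) → AdeleRing (𝓞 K) K))
    (φ : GL (Fin n) (AdeleRing (𝓞 K) K) → ℂ) (ξ : Fin (c + 1) → K) (x : GL (Fin n) (AdeleRing (𝓞 K) K)) :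
    colCoeff h ν φ ξ x = ((ν (piFundamentalDomain K (Fin (c + 1)))).toReal⁻¹ : ℝ) •
      ∫ v in piFundamentalDomain K (Fin (c + 1)),
        conj (adeleAddChar K (∑ i, algebraMap K (AdeleRing (𝓞 K) K) (ξ i) * v i) : ℂ) *
          φ (colUnipotent n h (Multiplicative.ofAdd v) * x) ∂ν :=
  rfl

variable {K} in
/-- **The column coefficients of a continuous function are continuous**: for `φ` continuous and
`ν` finite on compact sets, `x ↦ φ_ξ(x)` is continuous (dominated convergence: for `x` in a compact
neighbourhood `C` of `x₀` the integrand is bounded by `max |φ|` on the compact `u(closure D) · C`;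
cf. `continuous_whittakerCoeff` of `CuspidalWhittakerGL2`). [folklore] -/
theorem continuous_colCoeff [BorelSpace (AdeleRing (𝓞 K) K)] (h : c + 1 ≤ n)
    (ν : Measure (Fin (c + 1) → AdeleRing (𝓞 K) K)) [IsFiniteMeasureOnCompacts ν]
    {φ : GL (Fin n) (AdeleRing (𝓞 K) K) → ℂ} (hφc : Continuous φ) (ξ : Fin (c + 1) → K) :
    Continuous fun x => colCoeff h ν φ ξ x := by
  haveI := t2Space_adeleRing K
  haveI := secondCountableTopology_adeleRing K
  haveI : BorelSpace (Fin (c + 1) → AdeleRing (𝓞 K) K) := Pi.borelSpace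
  haveI : LocallyCompactSpace (GL (Fin n) (AdeleRing (𝓞 K) K)) :=
    AdelicGroupData.locallyCompactSpace_generalLinearGroup_adeleRing K (Fin n)
  haveI := secondCountableTopology_generalLinearGroup_adeleRing K (Fin n)
  set D := piFundamentalDomain K (Fin (c + 1)) with hD
  have hDm : MeasurableSet D := measurableSet_piFundamentalDomain K (Fin (c + 1))
  have hDc : IsCompact (closure D) := isCompact_closure_piFundamentalDomain K (Fin (c + 1))
  haveI : IsFiniteMeasure (ν.restrict D) :=
    isFiniteMeasure_restrict.2 ((measure_mono subset_closure).trans_lt hDc.measure_lt_top).ne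
  have hχc : Continuous fun v : Fin (c + 1) → AdeleRing (𝓞 K) K =>
      conj (adeleAddChar K (∑ i, algebraMap K (AdeleRing (𝓞 K) K) (ξ i) * v i) : ℂ) := by
    refine Complex.continuous_conj.comp (continuous_subtype_val.comp ((continuous_adeleAddChar K).comp ?_))
    exact continuous_finsetSum _ fun i _ => continuous_const.mul (continuous_apply i)
  have hu := continuous_colUnipotent (R := AdeleRing (𝓞 K) K) h
  have hcont : Continuous fun x : GL (Fin n) (AdeleRing (𝓞 K) K) => ∫ v in D,
      conj (adeleAddChar K (∑ i, algebraMap K (AdeleRing (𝓞 K) K) (ξ i) * v i) : ℂ) *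
        φ (colUnipotent n h (Multiplicative.ofAdd v) * x) ∂ν := by
    refine continuous_iff_continuousAt.2 fun x₀ => ?_
    obtain ⟨C, hCc, hCn⟩ := exists_compact_mem_nhds x₀
    have hcomp : IsCompact (((fun v => (colUnipotent n h (Multiplicative.ofAdd v) :
        GL (Fin n) (AdeleRing (𝓞 K) K))) '' closure D) * C) := (hDc.image hu).mul hCc
    obtain ⟨M, hM⟩ := hcomp.exists_bound_of_continuousOn hφc.continuousOn
    refine continuousAt_of_dominated (μ := ν.restrict D) (bound := fun _ => M) ?_ ?_ (integrable_const M) ?_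
    · exact Filter.Eventually.of_forall fun x =>
        (hχc.mul (hφc.comp (hu.mul continuous_const))).aestronglyMeasurable
    · filter_upwards [hCn] with x hx
      refine (ae_restrict_iff' hDm).2 (Filter.Eventually.of_forall fun v hv => ?_)
      rw [norm_mul, Complex.norm_conj, Circle.norm_coe, one_mul]
      exact hM _ (Set.mul_mem_mul ⟨v, subset_closure hv, rfl⟩ hx)
    · exact Filter.Eventually.of_forall fun v =>
        (continuous_const.mul (hφc.comp (continuous_const.mul continuous_id))).continuousAt
  exact hcont.const_smul ((ν D).toReal⁻¹ : ℝ)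

variable {K} in
omit [MeasurableSpace (AdeleRing (𝓞 K) K)] in
/-- The pairing of the last row of `γ` with `v` is the last coordinate of `γ_𝔸 v`:
`∑_j (e γ)_j v_j = ∑_i e_i (γ_𝔸 v)_i`. [folklore] -/
theorem sum_lastRow_mul_eq (γ : GL (Fin (c + 1)) K) (v : Fin (c + 1) → AdeleRing (𝓞 K) K) :
    ∑ i, algebraMap K (AdeleRing (𝓞 K) K) (lastRow γ i) * v i =
      ∑ i, algebraMap K (AdeleRing (𝓞 K) K) (lastVec c K i) *
        (((ratGL K γ : GL (Fin (c + 1)) (AdeleRing (𝓞 K) K)) :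
          Matrix (Fin (c + 1)) (Fin (c + 1)) (AdeleRing (𝓞 K) K)) *ᵥ v) i := by
  symm
  rw [Finset.sum_eq_single (Fin.last c)]
  · simp only [lastVec, Pi.single_eq_same, map_one, one_mul, Matrix.mulVec, dotProduct, ratGL_apply,
      lastRow_apply]
  · intro i _ hi
    simp [lastVec, hi]
  · intro h; exact absurd (Finset.mem_univ _) h

variable {K} in
omit [MeasurableSpace (AdeleRing (𝓞 K) K)] in
/-- `u(w) diag(γ_𝔸, 1) = diag(γ_𝔸, 1) u(γ⁻¹_𝔸 w)` for rational `γ`. [folklore] -/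
theorem colUnipotent_mul_glCorner_ratGL (h : c + 1 ≤ n) (γ : GL (Fin (c + 1)) K)
    (w : Fin (c + 1) → AdeleRing (𝓞 K) K) :
    colUnipotent n h (Multiplicative.ofAdd w) * glCorner (AdeleRing (𝓞 K) K) h (ratGL K γ) =
      glCorner (AdeleRing (𝓞 K) K) h (ratGL K γ) *
        colUnipotent n h (Multiplicative.ofAdd
          ((((ratGL K γ⁻¹ : GL (Fin (c + 1)) (AdeleRing (𝓞 K) K)) :
            Matrix (Fin (c + 1)) (Fin (c + 1)) (AdeleRing (𝓞 K) K)) *ᵥ w))) := by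
  rw [colUnipotent_mul_glCorner, ← map_inv]

variable {K} in
omit [MeasurableSpace (AdeleRing (𝓞 K) K)] in
/-- Periodicity of `φ` under `u(K^{c+1})` makes `v ↦ φ(u(v) x)` `K^{c+1}`-periodic. [folklore] -/
theorem periodic_comp_colUnipotent (h : c + 1 ≤ n) {φ : GL (Fin n) (AdeleRing (𝓞 K) K) → ℂ}
    (hper : ∀ (k : Fin (c + 1) → K) (x : GL (Fin n) (AdeleRing (𝓞 K) K)),
      φ (colUnipotent n h (Multiplicative.ofAdd fun i => algebraMap K (AdeleRing (𝓞 K) K) (k i)) * x) =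
        φ x)
    (x : GL (Fin n) (AdeleRing (𝓞 K) K)) (v : Fin (c + 1) → AdeleRing (𝓞 K) K) (ξ : Fin (c + 1) → K) :
    φ (colUnipotent n h (Multiplicative.ofAdd (v + fun i => algebraMap K (AdeleRing (𝓞 K) K) (ξ i))) * x) =
      φ (colUnipotent n h (Multiplicative.ofAdd v) * x) := by
  rw [add_comm v, colUnipotent_add, mul_assoc, hper]

variable {K} in
/-- The `ξ = 0` coefficient is the plain average `λ(D)⁻¹ ∫_D φ(u(v) x) dv` (the constant term along
the column group). [folklore] -/
theorem colCoeff_zero [BorelSpace (AdeleRing (𝓞 K) K)] (h : c + 1 ≤ n) (ν : Measure (Fin (c + 1) → AdeleRing (𝓞 K) K))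
    (φ : GL (Fin n) (AdeleRing (𝓞 K) K) → ℂ) (x : GL (Fin n) (AdeleRing (𝓞 K) K)) :
    colCoeff h ν φ 0 x = ((ν (piFundamentalDomain K (Fin (c + 1)))).toReal⁻¹ : ℝ) •
      ∫ v in piFundamentalDomain K (Fin (c + 1)), φ (colUnipotent n h (Multiplicative.ofAdd v) * x) ∂ν := by
  rw [colCoeff_apply]
  congr 1
  refine setIntegral_congr_fun (measurableSet_piFundamentalDomain K (Fin (c + 1))) fun v _ => ?_
  simp

variable {K} in
/-- **`φ_{e γ}(x) = φ_e(diag(γ, 1) x)`** (Cogdell (2004), proof of Thm. 1.1; Jacquet–Shalika (1981),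
§4): for `γ ∈ GL_{c+1}(K)` and `φ` continuous, left invariant under the rational corner
`diag(γ_𝔸, 1)` and under `u(K^{c+1})`, the coefficient at the row vector `e γ` is the coefficient at
`e` of the left translate by `diag(γ_𝔸, 1)` (`glCorner`). Proof:
`u(w) diag(γ,1) = diag(γ,1) u(γ⁻¹ w)`, invariance, and the rational change of variables `w = γ v`
on `D^{c+1}` (`setIntegral_piFundamentalDomain_comp_mulVec`). [cite: CogdellAnalyticTheory2004, §1.1] -/
theorem colCoeff_lastRow [BorelSpace (AdeleRing (𝓞 K) K)] (h : c + 1 ≤ n) (ν : Measure (Fin (c + 1) → AdeleRing (𝓞 K) K))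
    [ν.IsAddHaarMeasure] {φ : GL (Fin n) (AdeleRing (𝓞 K) K) → ℂ} (hφc : Continuous φ)
    (γ : GL (Fin (c + 1)) K)
    (hγ : ∀ x, φ (glCorner (AdeleRing (𝓞 K) K) h (ratGL K γ) * x) = φ x)
    (hper : ∀ (k : Fin (c + 1) → K) (x : GL (Fin n) (AdeleRing (𝓞 K) K)),
      φ (colUnipotent n h (Multiplicative.ofAdd fun i => algebraMap K (AdeleRing (𝓞 K) K) (k i)) * x) =
        φ x)
    (x : GL (Fin n) (AdeleRing (𝓞 K) K)) :
    colCoeff h ν φ (lastRow γ) x =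
      colCoeff h ν φ (lastVec c K) (glCorner (AdeleRing (𝓞 K) K) h (ratGL K γ) * x) := by
  -- `G` = the integrand of the left-hand side
  set G : (Fin (c + 1) → AdeleRing (𝓞 K) K) → ℂ := fun v =>
    conj (adeleAddChar K (∑ i, algebraMap K (AdeleRing (𝓞 K) K) (lastRow γ i) * v i) : ℂ) *
      φ (colUnipotent n h (Multiplicative.ofAdd v) * x) with hG
  have hGc : Continuous G := by
    refine Continuous.mul ?_ (hφc.comp ((continuous_colUnipotent h).mul continuous_const))
    refine Complex.continuous_conj.comp (continuous_subtype_val.comp ((continuous_adeleAddChar K).comp ?_))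
    exact continuous_finsetSum _ fun i _ => continuous_const.mul (continuous_apply i)
  have hGper : ∀ (v : Fin (c + 1) → AdeleRing (𝓞 K) K) (ξ : Fin (c + 1) → K),
      G (v + fun i => algebraMap K (AdeleRing (𝓞 K) K) (ξ i)) = G v := by
    intro v ξ
    simp only [hG]
    rw [periodic_comp_colUnipotent h hper]
    congr 2
    have hsplit : ∑ i, algebraMap K (AdeleRing (𝓞 K) K) (lastRow γ i) *
        (v + fun i => algebraMap K (AdeleRing (𝓞 K) K) (ξ i)) i =
        ∑ i, algebraMap K (AdeleRing (𝓞 K) K) (lastRow γ i) * v i +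
          algebraMap K (AdeleRing (𝓞 K) K) (∑ i, lastRow γ i * ξ i) := by
      simp only [Pi.add_apply, mul_add, Finset.sum_add_distrib, map_sum, map_mul]
    rw [hsplit, AddChar.map_add_eq_mul, adeleAddChar_algebraMap K, mul_one]
  -- the integrand of the right-hand side at `w` is `G (γ⁻¹ w)`
  have key : ∀ w : Fin (c + 1) → AdeleRing (𝓞 K) K,
      conj (adeleAddChar K (∑ i, algebraMap K (AdeleRing (𝓞 K) K) (lastVec c K i) * w i) : ℂ) *
        φ (colUnipotent n h (Multiplicative.ofAdd w) * (glCorner (AdeleRing (𝓞 K) K) h (ratGL K γ) * x)) =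
      G ((((ratGL K γ⁻¹ : GL (Fin (c + 1)) (AdeleRing (𝓞 K) K)) :
            Matrix (Fin (c + 1)) (Fin (c + 1)) (AdeleRing (𝓞 K) K)) *ᵥ w)) := by
    intro w
    simp only [hG]
    rw [sum_lastRow_mul_eq γ, mulVec_ratGL_mulVec_ratGL_inv]
    congr 1
    rw [← mul_assoc, colUnipotent_mul_glCorner_ratGL, mul_assoc, hγ]
  calc colCoeff h ν φ (lastRow γ) x
      = ((ν (piFundamentalDomain K (Fin (c + 1)))).toReal⁻¹ : ℝ) •
          ∫ v in piFundamentalDomain K (Fin (c + 1)), G v ∂ν := rfl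
    _ = ((ν (piFundamentalDomain K (Fin (c + 1)))).toReal⁻¹ : ℝ) •
          ∫ w in piFundamentalDomain K (Fin (c + 1)),
            G ((((ratGL K γ⁻¹ : GL (Fin (c + 1)) (AdeleRing (𝓞 K) K)) :
              Matrix (Fin (c + 1)) (Fin (c + 1)) (AdeleRing (𝓞 K) K)) *ᵥ w)) ∂ν := by
        rw [setIntegral_piFundamentalDomain_comp_mulVec ν γ⁻¹ hGc hGper]
    _ = colCoeff h ν φ (lastVec c K) (glCorner (AdeleRing (𝓞 K) K) h (ratGL K γ) * x) := by
        rw [colCoeff_apply]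
        congr 1
        exact setIntegral_congr_fun (measurableSet_piFundamentalDomain K (Fin (c + 1)))
          fun w _ => (key w).symm

variable {K} in
/-- **The column coefficient `Φ = φ_e` is left invariant under the rational mirabolic
`diag(P_{c+1}(K), 1)`** (the stabiliser of the character `ψ(v_c)`): for `p ∈ P_{c+1}(K)`,
`Φ(diag(p_𝔸, 1) x) = Φ(x)`. This is the invariance needed at the next stage of the tower.
[cite: CogdellAnalyticTheory2004, §1.1] -/
theorem colCoeff_lastVec_glCorner_of_mem_mirabolic [BorelSpace (AdeleRing (𝓞 K) K)] (h : c + 1 ≤ n)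
    (ν : Measure (Fin (c + 1) → AdeleRing (𝓞 K) K)) [ν.IsAddHaarMeasure]
    {φ : GL (Fin n) (AdeleRing (𝓞 K) K) → ℂ} (hφc : Continuous φ) {p : GL (Fin (c + 1)) K}
    (hp : p ∈ mirabolic c K) (hγ : ∀ x, φ (glCorner (AdeleRing (𝓞 K) K) h (ratGL K p) * x) = φ x)
    (hper : ∀ (k : Fin (c + 1) → K) (x : GL (Fin n) (AdeleRing (𝓞 K) K)),
      φ (colUnipotent n h (Multiplicative.ofAdd fun i => algebraMap K (AdeleRing (𝓞 K) K) (k i)) * x) =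
        φ x)
    (x : GL (Fin n) (AdeleRing (𝓞 K) K)) :
    colCoeff h ν φ (lastVec c K) (glCorner (AdeleRing (𝓞 K) K) h (ratGL K p) * x) =
      colCoeff h ν φ (lastVec c K) x := by
  rw [← colCoeff_lastRow h ν hφc p hγ hper x, mem_mirabolic_iff.1 hp]

variable {K} in
/-- **The stage identity (mean-square Fourier expansion along a column group), over `ξ ≠ 0`.**
Let `φ : GL_n(𝔸_K) → ℂ` be continuous and left invariant under `u(K^{c+1})`, and let `x` be a
point at which the constant term along the column group vanishes (`colCoeff h ν φ 0 x = 0`; for a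
cusp form and the last column this is cuspidality along `P_{(n-1,1)}`). Then
`∑_{ξ ∈ K^{c+1} ∖ 0} |φ_ξ(x)|² = λ(D)⁻¹ ∫_D |φ(u(v) x)|² dλ(v)` — Parseval on `K^{c+1} \ 𝔸_K^{c+1}`
(`AdeleRing.hasSum_norm_sq_inv_smul_setIntegral_piFundamentalDomain`) with the `ξ = 0` term removed.
[cite: JacquetShalikaAJM1981, §4] -/
theorem hasSum_norm_sq_colCoeff [BorelSpace (AdeleRing (𝓞 K) K)] (h : c + 1 ≤ n) (ν : Measure (Fin (c + 1) → AdeleRing (𝓞 K) K))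
    [ν.IsAddHaarMeasure] {φ : GL (Fin n) (AdeleRing (𝓞 K) K) → ℂ} (hφc : Continuous φ)
    (hper : ∀ (k : Fin (c + 1) → K) (x : GL (Fin n) (AdeleRing (𝓞 K) K)),
      φ (colUnipotent n h (Multiplicative.ofAdd fun i => algebraMap K (AdeleRing (𝓞 K) K) (k i)) * x) =
        φ x)
    (x : GL (Fin n) (AdeleRing (𝓞 K) K)) (hcusp : colCoeff h ν φ 0 x = 0) :
    HasSum (fun ξ : {ξ : Fin (c + 1) → K // ξ ≠ 0} => ‖colCoeff h ν φ ξ x‖ ^ 2)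
      ((ν (piFundamentalDomain K (Fin (c + 1)))).toReal⁻¹ *
        ∫ v in piFundamentalDomain K (Fin (c + 1)),
          ‖φ (colUnipotent n h (Multiplicative.ofAdd v) * x)‖ ^ 2 ∂ν) := by
  have hF : Continuous fun v : Fin (c + 1) → AdeleRing (𝓞 K) K =>
      φ (colUnipotent n h (Multiplicative.ofAdd v) * x) :=
    hφc.comp ((continuous_colUnipotent h).mul continuous_const)
  have hall := AdeleRing.hasSum_norm_sq_inv_smul_setIntegral_piFundamentalDomain K (Fin (c + 1)) ν hF
    (fun v ξ => periodic_comp_colUnipotent h hper x v ξ)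
  have hall' : HasSum (fun ξ : Fin (c + 1) → K => ‖colCoeff h ν φ ξ x‖ ^ 2)
      ((ν (piFundamentalDomain K (Fin (c + 1)))).toReal⁻¹ *
        ∫ v in piFundamentalDomain K (Fin (c + 1)),
          ‖φ (colUnipotent n h (Multiplicative.ofAdd v) * x)‖ ^ 2 ∂ν) := hall
  have hsupp : support (fun ξ : Fin (c + 1) → K => ‖colCoeff h ν φ ξ x‖ ^ 2) ⊆ {ξ | ξ ≠ 0} := by
    intro ξ hξ h0
    apply hξ
    change ‖colCoeff h ν φ ξ x‖ ^ 2 = 0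
    rw [show ξ = 0 from h0, hcusp, norm_zero, zero_pow two_ne_zero]
  exact (hasSum_subtype_iff_of_support_subset hsupp).2 hall'

variable {K} in
/-- **The stage identity over the mirabolic quotient** (Jacquet–Shalika (1981), §4; Cogdell (2004),
Thm. 1.1 in mean square): if moreover `φ` is left invariant under the whole rational corner
`diag(GL_{c+1}(K), 1)`, then
`λ(D)⁻¹ ∫_D |φ(u(v) x)|² dλ(v) = ∑_{γ ∈ P_{c+1}(K) \ GL_{c+1}(K)} |Φ(diag(γ_𝔸, 1) x)|²`,
`Φ = φ_e` the coefficient at the last row vector (summed over Mathlib's right-coset space of the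
mirabolic, any representative; re-indexed through `mirabolicQuotientEquiv` and `colCoeff_lastRow`).
[cite: JacquetShalikaAJM1981, §4] -/
theorem hasSum_norm_sq_colCoeff_mirabolic [BorelSpace (AdeleRing (𝓞 K) K)] (h : c + 1 ≤ n)
    (ν : Measure (Fin (c + 1) → AdeleRing (𝓞 K) K)) [ν.IsAddHaarMeasure]
    {φ : GL (Fin n) (AdeleRing (𝓞 K) K) → ℂ} (hφc : Continuous φ)
    (hinv : ∀ (γ : GL (Fin (c + 1)) K) (x : GL (Fin n) (AdeleRing (𝓞 K) K)),
      φ (glCorner (AdeleRing (𝓞 K) K) h (ratGL K γ) * x) = φ x)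
    (hper : ∀ (k : Fin (c + 1) → K) (x : GL (Fin n) (AdeleRing (𝓞 K) K)),
      φ (colUnipotent n h (Multiplicative.ofAdd fun i => algebraMap K (AdeleRing (𝓞 K) K) (k i)) * x) =
        φ x)
    (x : GL (Fin n) (AdeleRing (𝓞 K) K)) (hcusp : colCoeff h ν φ 0 x = 0) :
    HasSum (fun q : Quotient (QuotientGroup.rightRel (mirabolic c K)) =>
        ‖colCoeff h ν φ (lastVec c K) (glCorner (AdeleRing (𝓞 K) K) h (ratGL K q.out) * x)‖ ^ 2)
      ((ν (piFundamentalDomain K (Fin (c + 1)))).toReal⁻¹ *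
        ∫ v in piFundamentalDomain K (Fin (c + 1)),
          ‖φ (colUnipotent n h (Multiplicative.ofAdd v) * x)‖ ^ 2 ∂ν) := by
  have h1 := hasSum_norm_sq_colCoeff h ν hφc hper x hcusp
  rw [← hasSum_lastRow_out_iff (f := fun ξ => ‖colCoeff h ν φ ξ x‖ ^ 2)] at h1
  refine h1.congr_fun fun q => ?_
  rw [colCoeff_lastRow h ν hφc q.out (hinv q.out) hper x]

end Stage

end Literature.NumberTheory.Automorphic
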